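import Mathlib.Analysis.Seminorm
import Mathlib.Analysis.SpecialFunctions.Pow.Real
import Mathlib.Analysis.SpecificLimits.Basic
import Mathlib.Analysis.Normed.Group.InfiniteSum
import HarnessLib

/-!
# Feldman–Salmhofer–Trubowitz IV — from the scale bounds (Theorem 3) to the norm bounds of the
# iteration (Theorem 2 (1), (2)): the summation-over-scales argument — PROOFS

J. Feldman, M. Salmhofer, E. Trubowitz, *An inversion theorem in Fermi surface theory*, Comm. Pure
Appl. Math. **53** (2000) 1350–1384 = arXiv:math-ph/0001031 ("FST IV") [FeldmanSalmhoferTrubowitz2000].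
Render `paper:arxiv-math-ph_0001031`, locators `p.N:Ln` = chunk `pNNNN.txt`, line `n`.

Theorem 2 (2) "is proven by a multiscale analysis in which the function `K^{(R)}(E, λV)` is
represented as an infinite series `K^{(R)}(E,λV) = Σ_{j<0} K^{(R)}_j(E,λV)`" (p.9:L127–133); Theorem 3
("skalensatz", p.9:L139–185) gives the scale-by-scale bounds (line1) `|K_j(e)|_{3,r} ≤ Q̃|λ|M^{ε̃j}`,
(line3) `|K_j(e₁)−K_j(e₀)|₁ ≤ Q̃|λ|(M^{−1.1j}|e₁−e₀|₀ + M^{ε̃j}|e₁−e₀|₁)`,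
(line4) `|K_j(e₁)−K_j(e₀)|_{3,r} ≤ Q̃|λ|(M^{−2.1j}|e₁−e₀|₁ + M^{ε̃j} sup_t|e_t|_{3,r} |e₁−e₀|₀ + M^{ε̃j}|e₁−e₀|₂)`,
(line5) `|K_j(e,λV₁)−K_j(e,λV₂)|₂ ≤ Q̃|λ|M^{ε̃j}|V₁−V₂|₂`, and the text p.9:L190–p.10:L90 derives from them
Theorem 2 (1) (r1) "when summed over `j`, with `D_R = Q̃ M^{−ε̃}/(1−M^{−ε̃})`" and Theorem 2 (2)
(dr1), (dr2) (= (eq35)), (dr3) by SPLITTING THE SCALE SUM at `|e₁−e₀|₀ = M^{2j}` (resp.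
`|e₁−e₀|₁ = M^{3j}`) and interpolating — the step that produces the fractional powers `δ = ε̃/3`
(resp. `ε̃/4`) of Theorem 2.  ((dr0) is FST I Theorem 3.5, p.9:L191–192, not derived here.)

This file PROVES that derivation in the abstract setting of `FermiRG/FSTInversionIteration.lean`
(a real normed space `X` whose norm plays `|·|_{3,r}`, seminorms for the lower norms), with the scale
index `j < 0` re-indexed as `j' = −(j+1) ∈ ℕ` and `M^{cj} = (m^c)^{j'+1}`, `m = M⁻¹ ∈ (0,1)`; the scale
pieces `K_j(e_p)` enter as sequences `u, v : ℕ → X` and `K = Σ_j K_j` as their sum (`HasSum`).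
Theorem 3 itself (the multiscale input from FST I–III, §4 of the paper) is NOT typed; nothing is asserted
about the FST counterterm.  Results (all `[cite: FeldmanSalmhoferTrubowitz2000, …]`):
`norm_tsum_le_of_scale_bound` ((line1) ⇒ (r1), and (line5) ⇒ (dr3), p.9:L190–194),
`scale_interpolation` (the two-case estimate of one scale term, p.9:L196–p.10:L25 / p.10:L27–90, done
once for general exponents), `dr1_of_scale_bounds` (p.9:L196–p.10:L25, `δ = ε̃/3`,
`ε' = min{0.2, ε̃/3}`), `dr2_of_scale_bounds` (p.10:L27–90, `δ = ε̃/4`, `ε' = min{0.15, ε̃/4}`), with the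
printed constants `Q̃̃ = Q̃/(1−M^{−ε'})`, `Q₄ = Q̃/(1−M^{−ε'})` and the printed totals
`Q̃̃|λ|(3|e₁−e₀|₀^{ε̃/3} + |e₁−e₀|₁)`, `Q₄|λ|(3|e₁−e₀|₁^{ε̃/4} + S₃|e₁−e₀|₀ + |e₁−e₀|₂)`.  REMARK (docstring
of `dr2_of_scale_bounds`): the print proves (dr1) with `δ = ε̃/3` and (dr2) with `δ = ε̃/4` while
Theorem 2 (2) states one `δ`; on differences with `|e₁−e₀|₀ ≤ 1` the exponent `ε̃/3` may be replaced by
`ε̃/4` (`x^{ε̃/3} ≤ x^{ε̃/4}` for `x ≤ 1`), which is how a single `δ = ε̃/4` serves both.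

No definitions, no `sorry`, no named fact (net fact debt 0).  Typer lint: no `instance`, no `notation`.
-/

noncomputable section

open Filter Topology

namespace Literature.MathematicalPhysics.QuantumLattice.FermiRG

namespace FST4

variable {X : Type*} [NormedAddCommGroup X]

/-! ### Sums of seminorm-bounded series -/

section SeminormSums

variable [NormedSpace ℝ X]

/-- Finite subadditivity of a seminorm. [folklore] -/
private theorem seminorm_sum_le (p : Seminorm ℝ X) (g : ℕ → X) (n : ℕ) :
    p (∑ j ∈ Finset.range n, g j) ≤ ∑ j ∈ Finset.range n, p (g j) := by
  induction n with
  | zero => simp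
  | succ n ih =>
    rw [Finset.sum_range_succ, Finset.sum_range_succ]
    exact (map_add_le_add p _ _).trans (add_le_add ih le_rfl)

/-- A seminorm dominated by the norm passes to the sum of a convergent series term by term: if
`HasSum g s`, `p(g_j) ≤ b_j` and `Σ b_j` converges then `p(s) ≤ Σ_j b_j`.  (The step "when summed over
`j`", p.9:L190.) [folklore] -/
private theorem seminorm_hasSum_le (p : Seminorm ℝ X) (hp : ∀ x, p x ≤ ‖x‖) {g : ℕ → X} {s : X}
    (hg : HasSum g s) {b : ℕ → ℝ} (hb : Summable b) (hgb : ∀ j, p (g j) ≤ b j) :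
    p s ≤ ∑' j, b j := by
  have hb0 : ∀ j, 0 ≤ b j := fun j => (apply_nonneg p _).trans (hgb j)
  -- partial sums
  have hT : Tendsto (fun n => ∑ j ∈ Finset.range n, g j) atTop (𝓝 s) := hg.tendsto_sum_nat
  have hpT : Tendsto (fun n => p (∑ j ∈ Finset.range n, g j)) atTop (𝓝 (p s)) := by
    have h0 : Tendsto (fun n => ‖(∑ j ∈ Finset.range n, g j) - s‖) atTop (𝓝 0) :=
      tendsto_iff_norm_sub_tendsto_zero.1 hT
    have h1 : Tendsto (fun n => p (∑ j ∈ Finset.range n, g j) - p s) atTop (𝓝 0) := by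
      refine squeeze_zero_norm (fun n => ?_) h0
      rw [Real.norm_eq_abs]
      exact (abs_sub_map_le_sub p _ _).trans (hp _)
    have h2 := h1.add_const (p s)
    simpa using h2
  refine le_of_tendsto' hpT fun n => ?_
  calc p (∑ j ∈ Finset.range n, g j) ≤ ∑ j ∈ Finset.range n, p (g j) := seminorm_sum_le p g n
    _ ≤ ∑ j ∈ Finset.range n, b j := Finset.sum_le_sum fun j _ => hgb j
    _ ≤ ∑' j, b j := hb.sum_le_tsum (Finset.range n) fun j _ => hb0 j

end SeminormSums

/-! ### Geometric scale weights `M^{cj} = (m^c)^{j'+1}`, `m = 1/M` -/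

section Weights

variable {m : ℝ}

/-- `0 < m^c`. [folklore] -/
private theorem wpos (hm : 0 < m) (c : ℝ) : 0 < m ^ c := Real.rpow_pos_of_pos hm c

/-- `m^c < 1` for `0 < m < 1`, `c > 0`. [folklore] -/
private theorem wlt1 (hm : 0 < m) (hm1 : m < 1) {c : ℝ} (hc : 0 < c) : m ^ c < 1 :=
  Real.rpow_lt_one hm.le hm1 hc

/-- `Σ_{j<0} M^{cj} = Σ_{j'≥0} (m^c)^{j'+1} = m^c/(1 − m^c)` for `c > 0`. [folklore] -/
private theorem hasSum_weights (hm : 0 < m) (hm1 : m < 1) {c : ℝ} (hc : 0 < c) :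
    HasSum (fun j : ℕ => (m ^ c) ^ (j + 1)) (m ^ c / (1 - m ^ c)) := by
  have h := (hasSum_geometric_of_lt_one (wpos hm c).le (wlt1 hm hm1 hc)).mul_left (m ^ c)
  have heq : (fun j : ℕ => m ^ c * (m ^ c) ^ j) = fun j => (m ^ c) ^ (j + 1) := by
    funext j; rw [pow_succ]; ring
  rw [heq] at h
  rwa [div_eq_mul_inv]

/-- `m^c/(1−m^c) ≤ 1/(1−m^c)` (the printed constants use the latter). [folklore] -/
private theorem weightSum_le (hm : 0 < m) (hm1 : m < 1) {c : ℝ} (hc : 0 < c) :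
    m ^ c / (1 - m ^ c) ≤ 1 / (1 - m ^ c) :=
  div_le_div_of_nonneg_right (wlt1 hm hm1 hc).le (sub_pos.2 (wlt1 hm hm1 hc)).le

/-- `(m^c)^{j'+1} = (m^{j'+1})^c`. [folklore] -/
private theorem wpow (hm : 0 < m) (c : ℝ) (j : ℕ) : (m ^ c) ^ (j + 1) = (m ^ (j + 1)) ^ c :=
  Real.rpow_pow_comm hm.le c (j + 1)

end Weights

/-! ### (line1) summed over `j`: Theorem 2 (1) "(r1)" and, verbatim, (line5) ⇒ (dr3) -/

section R1

variable [NormedSpace ℝ X]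

/-- **"Eq. (line1) implies (r1) when summed over `j`, with `D_R = Q̃ M^{−ε̃}/(1−M^{−ε̃})`"**
(p.9:L190–191), and equally "by summation, (line5) implies continuity in the interaction `V`" (dr3)
(p.9:L193–194): if the scale pieces `u_{j'}` (`= K_j(e)`, or `= K_j(e,λV₁) − K_j(e,λV₂)`) obey
`‖u_{j'}‖ ≤ C (m^{ε̃})^{j'+1}` (`C = Q̃|λ|`, resp. `Q̃|λ||V₁−V₂|₂`; `m = 1/M`), then `Σ u_{j'}` converges
(in a complete `X`) and `‖Σ_{j'} u_{j'}‖ ≤ C m^{ε̃}/(1 − m^{ε̃})`.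
[cite: FeldmanSalmhoferTrubowitz2000, Thm 2 (1) from Thm 3 p.9:L190-194] -/
theorem norm_tsum_le_of_scale_bound [CompleteSpace X] {m εt C : ℝ} (hm : 0 < m) (hm1 : m < 1)
    (hεt : 0 < εt) {u : ℕ → X} (hu : ∀ j, ‖u j‖ ≤ C * (m ^ εt) ^ (j + 1)) :
    Summable u ∧ ‖∑' j, u j‖ ≤ C * (m ^ εt / (1 - m ^ εt)) := by
  have hw := hasSum_weights hm hm1 hεt
  have hsb : Summable fun j : ℕ => C * (m ^ εt) ^ (j + 1) := (hw.mul_left C).summable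
  have hsum : Summable u := Summable.of_norm_bounded hsb hu
  refine ⟨hsum, ?_⟩
  have h := seminorm_hasSum_le (normSeminorm ℝ X) (fun x => by simp) hsum.hasSum hsb
    (fun j => by simpa using hu j)
  rw [coe_normSeminorm] at h
  calc ‖∑' j, u j‖ ≤ ∑' j, C * (m ^ εt) ^ (j + 1) := h
    _ = C * (m ^ εt / (1 - m ^ εt)) := by rw [tsum_mul_left, hw.tsum_eq]

end R1

/-! ### The two-case interpolation estimate for one scale term -/

section Interpolation

/-- **The splitting-and-interpolation step, one scale at a time** (p.9:L196–p.10:L25 for (dr1);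
p.10:L27–90 for (dr2)), for general exponents.  A scale-`j` term `t = |K_j(e₁)−K_j(e₀)|` admits the two
printed bounds `t ≤ 2 Q̃|λ| M^{ε̃j}` ((line1) at `e₀` and `e₁`) and `t ≤ Q̃|λ|(M^{−aj} y + M^{ε̃j} z)`
((line3): `a = 1.1`, `y = |e₁−e₀|₀`, `z = |e₁−e₀|₁`; (line4): `a = 2.1`, `y = |e₁−e₀|₁`,
`z = S₃|e₁−e₀|₀ + |e₁−e₀|₂`).  Splitting at `y = M^{bj}` (`b = 2`, resp. `3`): if `y ≤ M^{bj}` then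
"`y ≤ (M^{bj})^{1−δ} y^δ`" gives `M^{−aj}y ≤ M^{(−a+b(1−δ))j} y^δ`; if `y > M^{bj}` then
"`y^{−δ} ≤ M^{−bδj}`" gives `t ≤ 2Q̃|λ| M^{(ε̃−bδ)j} y^δ`.  Hence, for any `0 < κ ≤ ε̃` with
`κ ≤ −a + b(1−δ)` and `κ ≤ ε̃ − bδ` (print: `κ = ε' = min{0.2, ε̃/3}`, resp. `min{0.15, ε̃/4}`),
`t ≤ Q̃|λ| M^{κj}(3y^δ + z)` (the printed total of the two partial sums).  Here `M^{cj} = (m^c)^{j'+1}`.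
[cite: FeldmanSalmhoferTrubowitz2000, Thm 2 (2) from Thm 3 p.9:L196-p.10:L25] -/
theorem scale_interpolation {m C εt a b δ κ t y z : ℝ} (hm : 0 < m) (hm1 : m < 1) (hC : 0 ≤ C)
    (hy : 0 ≤ y) (hz : 0 ≤ z) (hδ : 0 < δ) (hδ1 : δ ≤ 1) (hκε : κ ≤ εt)
    (hκA : κ ≤ -a + b * (1 - δ)) (hκB : κ ≤ εt - b * δ) (j : ℕ)
    (h1 : t ≤ 2 * C * (m ^ εt) ^ (j + 1))
    (h2 : t ≤ C * ((m ^ (-a)) ^ (j + 1) * y + (m ^ εt) ^ (j + 1) * z)) :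
    t ≤ C * (m ^ κ) ^ (j + 1) * (3 * y ^ δ + z) := by
  -- the scale `s = m^{j'+1} = M^j ∈ (0,1)`
  set s : ℝ := m ^ (j + 1) with hs
  have hs0 : 0 < s := pow_pos hm _
  have hs1 : s < 1 := pow_lt_one₀ hm.le hm1 (Nat.succ_ne_zero j)
  have hw : ∀ c : ℝ, (m ^ c) ^ (j + 1) = s ^ c := fun c => wpow hm c j
  simp only [hw] at h1 h2 ⊢
  have hyδ : 0 ≤ y ^ δ := Real.rpow_nonneg hy _
  have hsκ : 0 ≤ s ^ κ := (Real.rpow_pos_of_pos hs0 _).le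
  -- `c ↦ s^c` is antitone (`0 < s ≤ 1`)
  have smono : ∀ {c c' : ℝ}, c ≤ c' → s ^ c' ≤ s ^ c :=
    fun h => Real.rpow_le_rpow_of_exponent_ge hs0 hs1.le h
  have hεκ : s ^ εt ≤ s ^ κ := smono hκε
  by_cases hcase : y ≤ s ^ b
  · -- `y ≤ M^{bj}`: "`y ≤ (M^{bj})^{1-δ} y^δ`" hence `M^{-aj} y ≤ M^{(-a+b(1-δ))j} y^δ ≤ M^{κj} y^δ`
    have hy1 : y ≤ s ^ (b * (1 - δ)) * y ^ δ := by
      rcases eq_or_lt_of_le hy with hy0 | hy0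
      · rw [← hy0, Real.zero_rpow hδ.ne']; simp
      · have hsplit : y = y ^ (1 - δ) * y ^ δ := by
          rw [← Real.rpow_add hy0, sub_add_cancel, Real.rpow_one]
        calc y = y ^ (1 - δ) * y ^ δ := hsplit
          _ ≤ (s ^ b) ^ (1 - δ) * y ^ δ :=
              mul_le_mul_of_nonneg_right (Real.rpow_le_rpow hy hcase (sub_nonneg.2 hδ1)) hyδ
          _ = s ^ (b * (1 - δ)) * y ^ δ := by rw [← Real.rpow_mul hs0.le]
    have hA : s ^ (-a) * y ≤ s ^ κ * y ^ δ := by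
      calc s ^ (-a) * y ≤ s ^ (-a) * (s ^ (b * (1 - δ)) * y ^ δ) :=
            mul_le_mul_of_nonneg_left hy1 (Real.rpow_pos_of_pos hs0 _).le
        _ = s ^ (-a + b * (1 - δ)) * y ^ δ := by rw [Real.rpow_add hs0]; ring
        _ ≤ s ^ κ * y ^ δ := mul_le_mul_of_nonneg_right (smono hκA) hyδ
    calc t ≤ C * (s ^ (-a) * y + s ^ εt * z) := h2
      _ ≤ C * (s ^ κ * y ^ δ + s ^ κ * z) := by
          apply mul_le_mul_of_nonneg_left _ hC
          exact add_le_add hA (mul_le_mul_of_nonneg_right hεκ hz)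
      _ = C * s ^ κ * (y ^ δ + z) := by ring
      _ ≤ C * s ^ κ * (3 * y ^ δ + z) := by
          apply mul_le_mul_of_nonneg_left _ (mul_nonneg hC hsκ)
          linarith
  · -- `y > M^{bj}`: "`y^{-δ} ≤ M^{-bδj}`" hence `M^{εt j} ≤ M^{(εt-bδ)j} y^δ ≤ M^{κj} y^δ`
    have hcase : s ^ b < y := lt_of_not_ge hcase
    have hsb : 0 < s ^ b := Real.rpow_pos_of_pos hs0 _
    have hpow : s ^ (b * δ) ≤ y ^ δ := by
      rw [Real.rpow_mul hs0.le]
      exact Real.rpow_le_rpow hsb.le hcase.le hδ.le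
    have hB : s ^ εt ≤ s ^ κ * y ^ δ := by
      calc s ^ εt = s ^ (εt - b * δ) * s ^ (b * δ) := by
            rw [← Real.rpow_add hs0, sub_add_cancel]
        _ ≤ s ^ (εt - b * δ) * y ^ δ :=
            mul_le_mul_of_nonneg_left hpow (Real.rpow_pos_of_pos hs0 _).le
        _ ≤ s ^ κ * y ^ δ := mul_le_mul_of_nonneg_right (smono hκB) hyδ
    calc t ≤ 2 * C * s ^ εt := h1
      _ ≤ 2 * C * (s ^ κ * y ^ δ) := mul_le_mul_of_nonneg_left hB (by positivity)
      _ = C * s ^ κ * (2 * y ^ δ + 0) := by ring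
      _ ≤ C * s ^ κ * (3 * y ^ δ + z) := by
          apply mul_le_mul_of_nonneg_left _ (mul_nonneg hC hsκ)
          linarith

end Interpolation

/-! ### Theorem 2 (2): (dr1) and (dr2) = (eq35) from Theorem 3 -/

section DR

variable [NormedSpace ℝ X] [CompleteSpace X]

omit [CompleteSpace X] in
/-- The summed form: from a termwise bound `t_j ≤ C (m^κ)^{j'+1} A` to `Σ t_j ≤ C A/(1 − m^κ)`
(geometric series; the printed constants `Q̃̃ = Q̃/(1 − M^{−ε'})`, `Q₄` likewise, p.10:L7, L70).
[folklore] -/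
private theorem seminorm_tsum_sub_le (p : Seminorm ℝ X) (hp : ∀ x, p x ≤ ‖x‖) {u v : ℕ → X}
    (hsu : Summable u) (hsv : Summable v) {m κ C A : ℝ} (hm : 0 < m) (hm1 : m < 1) (hκ : 0 < κ)
    (hC : 0 ≤ C) (hA : 0 ≤ A) (ht : ∀ j, p (u j - v j) ≤ C * (m ^ κ) ^ (j + 1) * A) :
    p (∑' j, u j - ∑' j, v j) ≤ C * (1 / (1 - m ^ κ)) * A := by
  have hw := hasSum_weights hm hm1 hκ
  have hsb : Summable fun j : ℕ => C * (m ^ κ) ^ (j + 1) * A := by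
    have := (hw.mul_left C).mul_right A
    exact this.summable
  have hsum : HasSum (fun j => u j - v j) (∑' j, u j - ∑' j, v j) := hsu.hasSum.sub hsv.hasSum
  have h := seminorm_hasSum_le p hp hsum hsb ht
  calc p (∑' j, u j - ∑' j, v j) ≤ ∑' j, C * (m ^ κ) ^ (j + 1) * A := h
    _ = C * (m ^ κ / (1 - m ^ κ)) * A := by
        rw [tsum_mul_right, tsum_mul_left, hw.tsum_eq]
    _ ≤ C * (1 / (1 - m ^ κ)) * A := by
        apply mul_le_mul_of_nonneg_right _ hA
        exact mul_le_mul_of_nonneg_left (weightSum_le hm hm1 hκ) hC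

/-- **Theorem 2 (2), (dr1), from Theorem 3** (p.9:L196–p.10:L25): "To prove (dr1), with `δ = ε̃/3`,
we split the sum over `j` in two parts. If `j` is such that `|e₁−e₀|₀ ≤ M^{2j}`, then
`|e₁−e₀|₀ ≤ (M^{2j})^{1−ε̃/3}|e₁−e₀|₀^{ε̃/3}` implies, by (line3),
`|K_j(e₁) − K_j(e₀)|₁ ≤ Q̃|λ|(M^{0.2j}|e₁−e₀|₀^{ε̃/3} + M^{ε̃j}|e₁−e₀|₁)` …
`Σ_{j : |e₁−e₀|₀ ≤ M^{2j}} |K_j(e₁) − K_j(e₀)|₁ ≤ Q̃̃|λ|(|e₁−e₀|₀^{ε̃/3} + |e₁−e₀|₁)` with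
`Q̃̃ = Q̃/(1−M^{−ε'})`, `ε' = min{0.2, ε̃/3}`.  If `|e₁−e₀|₀ > M^{2j}`, then
`|e₁−e₀|₀^{−ε̃/3} ≤ M^{−2ε̃j/3}` and, by (line1), … `Σ_{j : |e₁−e₀|₀ > M^{2j}} |K_j(e₁) − K_j(e₀)|₁ ≤
2Q̃̃|λ||e₁−e₀|₀^{ε̃/3}`."  Abstractly: `u_{j'} = K_j(e₁)`, `v_{j'} = K_j(e₀)`, `f = e₁ − e₀`,
`C = Q̃|λ|`, `m = 1/M`; hypotheses (line1) at `e₀`, `e₁` and (line3); conclusion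
`|Σ_j K_j(e₁) − Σ_j K_j(e₀)|₁ ≤ Q̃̃|λ|(3|f|₀^{ε̃/3} + |f|₁)`, i.e. (dr1) with `Q₀ = 3Q̃̃`, `δ = ε̃/3`.
[cite: FeldmanSalmhoferTrubowitz2000, Thm 2 (2) (dr1) from Thm 3 p.9:L196-p.10:L25] -/
theorem dr1_of_scale_bounds (N0 N1 : Seminorm ℝ X) (hN1 : ∀ x, N1 x ≤ ‖x‖)
    {m εt C : ℝ} (hm : 0 < m) (hm1 : m < 1) (hεt : 0 < εt) (hεt1 : εt < 1) (hC : 0 ≤ C)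
    {u v : ℕ → X} (f : X)
    (hu : ∀ j, ‖u j‖ ≤ C * (m ^ εt) ^ (j + 1)) (hv : ∀ j, ‖v j‖ ≤ C * (m ^ εt) ^ (j + 1))
    (h3 : ∀ j, N1 (u j - v j) ≤
      C * ((m ^ (-(11 / 10 : ℝ))) ^ (j + 1) * N0 f + (m ^ εt) ^ (j + 1) * N1 f)) :
    Summable u ∧ Summable v ∧
    N1 (∑' j, u j - ∑' j, v j) ≤
      C * (1 / (1 - m ^ min (1 / 5 : ℝ) (εt / 3))) * (3 * N0 f ^ (εt / 3) + N1 f) := by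
  have hsu := (norm_tsum_le_of_scale_bound hm hm1 hεt hu).1
  have hsv := (norm_tsum_le_of_scale_bound hm hm1 hεt hv).1
  refine ⟨hsu, hsv, ?_⟩
  set κ : ℝ := min (1 / 5 : ℝ) (εt / 3) with hκdef
  have hκ : 0 < κ := lt_min (by norm_num) (by linarith)
  have hκε : κ ≤ εt := (min_le_right _ _).trans (by linarith)
  have hκA : κ ≤ -(11 / 10 : ℝ) + 2 * (1 - εt / 3) := (min_le_left _ _).trans (by linarith)
  have hκB : κ ≤ εt - 2 * (εt / 3) := (min_le_right _ _).trans (by linarith)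
  have hy : 0 ≤ N0 f := apply_nonneg _ _
  have hz : 0 ≤ N1 f := apply_nonneg _ _
  have ht : ∀ j, N1 (u j - v j) ≤ C * (m ^ κ) ^ (j + 1) * (3 * N0 f ^ (εt / 3) + N1 f) := by
    intro j
    have h1 : N1 (u j - v j) ≤ 2 * C * (m ^ εt) ^ (j + 1) := by
      calc N1 (u j - v j) ≤ N1 (u j) + N1 (v j) := map_sub_le_add N1 _ _
        _ ≤ ‖u j‖ + ‖v j‖ := add_le_add (hN1 _) (hN1 _)
        _ ≤ C * (m ^ εt) ^ (j + 1) + C * (m ^ εt) ^ (j + 1) := add_le_add (hu j) (hv j)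
        _ = 2 * C * (m ^ εt) ^ (j + 1) := by ring
    exact scale_interpolation hm hm1 hC hy hz (by linarith) (by linarith) hκε hκA hκB j h1 (h3 j)
  have hA : 0 ≤ 3 * N0 f ^ (εt / 3) + N1 f := by positivity
  exact seminorm_tsum_sub_le N1 hN1 hsu hsv hm hm1 hκ hC hA ht

/-- **Theorem 2 (2), (dr2) = (eq35), from Theorem 3** (p.10:L27–90): "To prove (eq35), with `δ = ε̃/4`,
we split the sum over `j` at `|e₁−e₀|₁ = M^{3j}`.  This time, writing `S₃ = sup_{t∈[0,1]}|e_t|_{3,r}`,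
and using `|e₁−e₀|₁ ≤ (M^{3j})^{1−ε̃/4}|e₁−e₀|₁^{ε̃/4}` when `|e₁−e₀|₁ ≤ M^{3j}` gives, by (line4), …
`Σ_{j : |e₁−e₀|₁ ≤ M^{3j}} |K_j(e₁) − K_j(e₀)|_{3,r} ≤ Q₄|λ|(|e₁−e₀|₁^{ε̃/4} + S₃|e₁−e₀|₀ + |e₁−e₀|₂)`
with `Q₄ = Q̃/(1−M^{−ε'})`, `ε' = min{0.15, ε̃/4}` … `Σ_{j : |e₁−e₀|₁ > M^{3j}} |K_j(e₁) − K_j(e₀)|_{3,r}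
≤ 2Q₄|λ||e₁−e₀|₁^{ε̃/4}`."  Abstractly as in `dr1_of_scale_bounds`, with the norm of `X` for
`|·|_{3,r}` and any `S₃ ≥ 0`: (dr2) with `Q₀ = 3Q₄`, `Q₁ = Q₄`, `δ = ε̃/4`.  REMARK: the print derives
(dr1) with `δ = ε̃/3` and (dr2) with `δ = ε̃/4`, while Theorem 2 (2) has one `δ`; for `|e₁−e₀|₀ ≤ 1`
(differences inside the ball) `|e₁−e₀|₀^{ε̃/3} ≤ |e₁−e₀|₀^{ε̃/4}`, so `δ = ε̃/4` serves both.
[cite: FeldmanSalmhoferTrubowitz2000, Thm 2 (2) (dr2) from Thm 3 p.10:L27-90] -/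
theorem dr2_of_scale_bounds (N0 N1 N2 : Seminorm ℝ X)
    {m εt C S₃ : ℝ} (hm : 0 < m) (hm1 : m < 1) (hεt : 0 < εt) (hεt1 : εt < 1) (hC : 0 ≤ C)
    (hS : 0 ≤ S₃) {u v : ℕ → X} (f : X)
    (hu : ∀ j, ‖u j‖ ≤ C * (m ^ εt) ^ (j + 1)) (hv : ∀ j, ‖v j‖ ≤ C * (m ^ εt) ^ (j + 1))
    (h4 : ∀ j, ‖u j - v j‖ ≤
      C * ((m ^ (-(21 / 10 : ℝ))) ^ (j + 1) * N1 f + (m ^ εt) ^ (j + 1) * (S₃ * N0 f + N2 f))) :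
    Summable u ∧ Summable v ∧
    ‖∑' j, u j - ∑' j, v j‖ ≤
      C * (1 / (1 - m ^ min (3 / 20 : ℝ) (εt / 4))) * (3 * N1 f ^ (εt / 4) + (S₃ * N0 f + N2 f)) := by
  have hsu := (norm_tsum_le_of_scale_bound hm hm1 hεt hu).1
  have hsv := (norm_tsum_le_of_scale_bound hm hm1 hεt hv).1
  refine ⟨hsu, hsv, ?_⟩
  set κ : ℝ := min (3 / 20 : ℝ) (εt / 4) with hκdef
  have hκ : 0 < κ := lt_min (by norm_num) (by linarith)
  have hκε : κ ≤ εt := (min_le_right _ _).trans (by linarith)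
  have hκA : κ ≤ -(21 / 10 : ℝ) + 3 * (1 - εt / 4) := (min_le_left _ _).trans (by linarith)
  have hκB : κ ≤ εt - 3 * (εt / 4) := (min_le_right _ _).trans (by linarith)
  have hy : 0 ≤ N1 f := apply_nonneg _ _
  have hz : 0 ≤ S₃ * N0 f + N2 f := add_nonneg (mul_nonneg hS (apply_nonneg _ _)) (apply_nonneg _ _)
  have ht : ∀ j, ‖u j - v j‖ ≤
      C * (m ^ κ) ^ (j + 1) * (3 * N1 f ^ (εt / 4) + (S₃ * N0 f + N2 f)) := by
    intro j
    have h1 : ‖u j - v j‖ ≤ 2 * C * (m ^ εt) ^ (j + 1) := by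
      calc ‖u j - v j‖ ≤ ‖u j‖ + ‖v j‖ := norm_sub_le _ _
        _ ≤ C * (m ^ εt) ^ (j + 1) + C * (m ^ εt) ^ (j + 1) := add_le_add (hu j) (hv j)
        _ = 2 * C * (m ^ εt) ^ (j + 1) := by ring
    exact scale_interpolation hm hm1 hC hy hz (by linarith) (by linarith) hκε hκA hκB j h1 (h4 j)
  have hA : 0 ≤ 3 * N1 f ^ (εt / 4) + (S₃ * N0 f + N2 f) :=
    add_nonneg (mul_nonneg (by norm_num) (Real.rpow_nonneg hy _)) hz
  have h := seminorm_tsum_sub_le (normSeminorm ℝ X) (fun x => by simp) hsu hsv hm hm1 hκ hC hA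
    (fun j => by simpa using ht j)
  simpa using h

end DR

end FST4

end Literature.MathematicalPhysics.QuantumLattice.FermiRG
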